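import Summits.AnomalousDissipation.AnomalousDissipation.Theorems.GenericRunawayStokesScaling.Negative.HelicitySqueeze
import Summits.AnomalousDissipation.AnomalousDissipation.Theorems.GenericRunawayStokesScaling.Negative.Cone

/-!
# Top-shell maximally-helical forces at every resolution `N`: Beltrami states are truncated-Euler states,
# the general helicity squeeze, and the polarised energy/helicity identities

Negative-side structure lemmas for the crux `MirrorVariety.GenericRunawayStokesScaling` (stmt-AnomalousDissipation-2990),
lead prover of line `idea-sketch-ideator3` (stub K1′).  For the punctured ball `S_N = PB N` and a real solenoidal force
`g` supported on the TOP shell `|k| = N` with `2πi k × ĝ_k = 2πN ĝ_k` (maximal helicity):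

* `projB_self_eq_zero_of_beltrami` — every `λ`-Beltrami coefficient vector (`2πi k × c_k = λ c_k` for all `k`) is a
  truncated-Euler steady state, `Q_S(c,c) = 0`, at EVERY resolution (Fourier Lamb identity: the two vortex terms cancel,
  the Bernoulli gradient is killed by the Leray symbol).  This replaces the `N = 2` "no top-shell triads" argument of
  `HelicitySqueeze`.
* `beltrami_of_sum_stokesW_mul_eq_zero` — the squeeze core: `∑_k 4π²|k|² (Re⟪c_k, 2πi k×c_k⟫ - 2πN‖c_k‖²) = 0` on `S_N`
  forces `2πi k × c_k = 2πN c_k` for every `k` (per-mode rigidity `curlVec_eq_smul_of_re_inner_eq`).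
* `topShell_squeeze` — for such `g`, every zero `(c, ν)` of `V_N(g)` with `ν ≠ 0` is `2πN`-Beltrami and equals the
  Stokes state `c = ĝ/(4π²N²ν)`: `V_N(g) ∖ {ν = 0}` is EXACTLY the Stokes hyperbola, at every `N`.
* `sum_re_inner_symB_eq_neg` (polarised energy identity `⟨L_a v, v⟩ = -⟨Q(v), a⟩`) and `sum_re_inner_symB_curl_eq_neg`
  (polarised helicity identity `⟨L_U v, curl U⟩ = -⟨Q(U), curl v⟩` at an ARBITRARY state `U`).
-/

set_option linter.dupNamespace false

noncomputable section

open scoped BigOperators InnerProductSpace ComplexConjugate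
open Filter Set Function

namespace Summit.AnomalousDissipation.AnomalousDissipation.Theorems.GenericRunawayStokesScaling.Negative

open Literature.Analysis.FunctionSpaces Literature.Analysis.FunctionSpaces.Torus
open Literature.Analysis.FluidPDE Literature.Analysis.FluidPDE.Torus
open Summit.AnomalousDissipation.AnomalousDissipation.Theses.MirrorVariety

section TopShell

variable {S : Finset (Fin 3 → ℤ)}

/-! ### Beltrami coefficient vectors are truncated-Euler states -/

/-- The Leray symbol kills the frequency direction: `Π_k (a k̂) = 0` for `k ≠ 0`. [folklore] -/
theorem leraySym_smul_freqVec' {k : Fin 3 → ℤ} (hk : k ≠ 0) (a : ℂ) : leraySym k (a • freqVec k) = 0 := by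
  have hk2 : ((freqNormSq k : ℝ) : ℂ) ≠ 0 := by
    have : freqNormSq k ≠ 0 := fun h => hk ((freqNormSq_eq_zero_iff k).1 h)
    exact_mod_cast this
  rw [leraySym_smul, leraySym_def]
  have hsum : ∑ i, (k i : ℂ) * freqVec k i = ((freqNormSq k : ℝ) : ℂ) := sum_mul_freqVec k
  rw [hsum, div_self hk2, one_smul, sub_self, smul_zero]

/-- `crossC` is antisymmetric. [folklore] -/
theorem crossC_antisymm (a b : EuclideanSpace ℂ (Fin 3)) : crossC a b = -crossC b a := by
  ext i; fin_cases i <;> simp <;> ring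

/-- The curl symbol of the zero vector vanishes. [folklore] -/
theorem curlVec_zero (k : Fin 3 → ℤ) : curlVec k (0 : EuclideanSpace ℂ (Fin 3)) = 0 := by
  ext i; fin_cases i <;> simp [curlVec]

/-- **Beltrami states are truncated-Euler states, at every resolution.**  If `2πi k × c_k = λ c_k` for every
`k ∈ S` (`0 ∉ S`), then `Q_S(c,c) = 0`: in the Lamb form of `2B(c,c)_k` the two vortex terms are
`λ (c_l × c_m + c_m × c_l) = 0` and the Bernoulli term is parallel to `k`, hence Leray-invisible. [folklore] -/
theorem projB_self_eq_zero_of_beltrami (hS0 : (0 : Fin 3 → ℤ) ∉ S) {c : ↥S → EuclideanSpace ℂ (Fin 3)} {lam : ℂ}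
    (hbel : ∀ k : ↥S, curlVec (k : Fin 3 → ℤ) (c k) = lam • c k) : projB S c c = 0 := by
  set C := coeffExt S c with hC
  have hbelC : ∀ l : Fin 3 → ℤ, curlVec l (C l) = lam • C l := by
    intro l
    by_cases hl : l ∈ S
    · rw [hC, coeffExt_of_mem c hl]; exact hbel ⟨l, hl⟩
    · rw [hC, coeffExt_of_not_mem c hl, curlVec_zero, smul_zero]
  funext k
  have hk : (k : Fin 3 → ℤ) ≠ 0 := fun h => hS0 (h ▸ k.2)
  rw [Pi.zero_apply, projB]
  -- `2 B_k = (∑ 2πi (c_l·c_m)) k̂`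
  have hlamb := two_smul_convectionCoeff_lamb (S := S) C k
  have hsum : (2 : ℂ) • convectionCoeff S C C k =
      (∑ l ∈ S, ∑ m ∈ S, if l + m = k then 2 * Real.pi * Complex.I * bdot (C l) (C m) else 0) •
        freqVec (k : Fin 3 → ℤ) := by
    rw [hlamb, Finset.sum_smul]
    refine Finset.sum_congr rfl fun l _ => ?_
    rw [Finset.sum_smul]
    refine Finset.sum_congr rfl fun m _ => ?_
    split_ifs with h
    · rw [hbelC l, hbelC m, crossC_smul_left, crossC_smul_left, crossC_antisymm (C m) (C l), smul_neg,
        add_neg_cancel, zero_add]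
    · rw [zero_smul]
  have h2 : (2 : ℂ) • leraySym (k : Fin 3 → ℤ) (convectionCoeff S C C k) = 0 := by
    rw [← leraySym_smul, hsum, leraySym_smul_freqVec' hk]
  have h2' : (2 : ℂ) ≠ 0 := two_ne_zero
  exact (smul_eq_zero.1 h2).resolve_left h2'

/-! ### Per-mode rigidity and the squeeze core -/

/-- **Per-mode rigidity of the curl symbol**: if `2π|k| ≤ λ` and `Re⟪v, 2πi k×v⟫ = λ‖v‖²`, then `2πi k × v = λ v`
(`‖2πi k×v‖ ≤ λ‖v‖`, so `‖2πi k×v - λv‖² = ‖2πi k×v‖² - λ²‖v‖² ≤ 0`). [folklore] -/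
theorem curlVec_eq_smul_of_re_inner_eq {k : Fin 3 → ℤ} {v : EuclideanSpace ℂ (Fin 3)} {lam : ℝ}
    (hk : 2 * Real.pi * Real.sqrt (freqNormSq k) ≤ lam) (h : (inner ℂ v (curlVec k v)).re = lam * ‖v‖ ^ 2) :
    curlVec k v = (lam : ℂ) • v := by
  have hlam : 0 ≤ lam := le_trans (by positivity) hk
  have hW : ‖curlVec k v‖ ≤ lam * ‖v‖ := by
    have h2 : ‖curlVec k v‖ = 2 * Real.pi * ‖crossK k v‖ := by
      rw [curlVec, norm_smul]
      congr 1
      rw [norm_mul, norm_mul, Complex.norm_I, mul_one, Complex.norm_real, Complex.norm_ofNat,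
        Real.norm_of_nonneg Real.pi_pos.le]
    rw [h2]
    calc 2 * Real.pi * ‖crossK k v‖ ≤ 2 * Real.pi * (Real.sqrt (freqNormSq k) * ‖v‖) := by
          gcongr; exact norm_crossK_le k v
      _ = (2 * Real.pi * Real.sqrt (freqNormSq k)) * ‖v‖ := by ring
      _ ≤ lam * ‖v‖ := mul_le_mul_of_nonneg_right hk (norm_nonneg _)
  have hsq : ‖curlVec k v - (lam : ℂ) • v‖ ^ 2 ≤ 0 := by
    rw [@norm_sub_sq ℂ, inner_smul_right, RCLike.re_to_complex, ← inner_conj_symm, Complex.mul_re,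
      Complex.conj_re, Complex.conj_im, Complex.ofReal_re, Complex.ofReal_im, h, norm_smul, Complex.norm_real,
      Real.norm_of_nonneg hlam]
    have hW2 : ‖curlVec k v‖ ^ 2 ≤ (lam * ‖v‖) ^ 2 := pow_le_pow_left₀ (norm_nonneg _) hW 2
    nlinarith [hW2]
  have h0 : ‖curlVec k v - (lam : ℂ) • v‖ ^ 2 = 0 := le_antisymm hsq (sq_nonneg _)
  rw [← sub_eq_zero]
  exact norm_eq_zero.1 (pow_eq_zero_iff two_ne_zero |>.1 h0)

/-- `2π|k| ≤ 2πN` on the punctured ball. [folklore] -/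
theorem two_pi_sqrt_le {N : ℕ} (k : ↥(PB N)) : 2 * Real.pi * Real.sqrt (freqNormSq (k : Fin 3 → ℤ)) ≤ 2 * Real.pi * N := by
  have hk2 : freqNormSq (k : Fin 3 → ℤ) ≤ (N : ℝ) ^ 2 := by
    have := (mem_PB_iff.1 k.2).2
    rw [freqNormSq_eq_intCast]; exact_mod_cast this
  have hsq : Real.sqrt (freqNormSq (k : Fin 3 → ℤ)) ≤ N := by
    rw [show (N : ℝ) = Real.sqrt ((N : ℝ) ^ 2) by rw [Real.sqrt_sq (Nat.cast_nonneg N)]]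
    exact Real.sqrt_le_sqrt hk2
  exact mul_le_mul_of_nonneg_left hsq (by positivity)

/-- Each squeezed term is nonpositive: `4π²|k|² (Re⟪c_k, 2πi k×c_k⟫ - 2πN‖c_k‖²) ≤ 0` on `S_N`. [folklore] -/
theorem stokesW_mul_sub_nonpos {N : ℕ} (k : ↥(PB N)) (v : EuclideanSpace ℂ (Fin 3)) :
    stokesW (k : Fin 3 → ℤ) * ((inner ℂ v (curlVec (k : Fin 3 → ℤ) v)).re - 2 * Real.pi * N * ‖v‖ ^ 2) ≤ 0 := by
  have hb := re_inner_curlVec_self_le (k : Fin 3 → ℤ) v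
  have hk := two_pi_sqrt_le k
  have : (inner ℂ v (curlVec (k : Fin 3 → ℤ) v)).re - 2 * Real.pi * N * ‖v‖ ^ 2 ≤ 0 := by
    nlinarith [sq_nonneg ‖v‖, mul_le_mul_of_nonneg_right hk (sq_nonneg ‖v‖)]
  exact mul_nonpos_of_nonneg_of_nonpos (stokesW_nonneg _) this

/-- Stokes weights are positive on the punctured ball. [folklore] -/
theorem stokesW_pos {N : ℕ} (k : ↥(PB N)) : 0 < stokesW (k : Fin 3 → ℤ) := by
  have hkpos : 0 < freqNormSq (k : Fin 3 → ℤ) := by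
    have := one_le_sum_sq_of_ne_zero (mem_PB_iff.1 k.2).1
    rw [freqNormSq_eq_intCast]; exact_mod_cast this
  simp only [stokesW]; positivity

/-- **The squeeze core.**  If `∑_k 4π²|k|² (Re⟪c_k, 2πi k×c_k⟫ - 2πN‖c_k‖²) = 0` on `S_N`, then `c` is
`2πN`-Beltrami: `2πi k × c_k = 2πN c_k` for every `k`. [folklore] -/
theorem beltrami_of_sum_stokesW_mul_eq_zero {N : ℕ} {c : ↥(PB N) → EuclideanSpace ℂ (Fin 3)}
    (h : ∑ k : ↥(PB N), stokesW (k : Fin 3 → ℤ) *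
      ((inner ℂ (c k) (curlVec (k : Fin 3 → ℤ) (c k))).re - 2 * Real.pi * N * ‖c k‖ ^ 2) = 0) :
    ∀ k : ↥(PB N), curlVec (k : Fin 3 → ℤ) (c k) = ((2 * Real.pi * N : ℝ) : ℂ) • c k := by
  intro k
  have hterm := (Finset.sum_eq_zero_iff_of_nonpos fun k (_ : k ∈ (Finset.univ : Finset ↥(PB N))) =>
    stokesW_mul_sub_nonpos k (c k)).1 h k (Finset.mem_univ k)
  have h1 : (inner ℂ (c k) (curlVec (k : Fin 3 → ℤ) (c k))).re - 2 * Real.pi * N * ‖c k‖ ^ 2 = 0 := by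
    rcases mul_eq_zero.1 hterm with h | h
    · exact absurd h (stokesW_pos k).ne'
    · exact h
  exact curlVec_eq_smul_of_re_inner_eq (two_pi_sqrt_le k) (by linarith)

/-! ### The general helicity squeeze -/

/-- **THE HELICITY SQUEEZE at every resolution `N`.**  If `g` is supported on the top shell `|k|² = N²` and
maximally helical (`2πi k × ĝ_k = 2πN ĝ_k`), then every zero `(c, ν)` of `V_N(g)` with `ν ≠ 0` is `2πN`-Beltrami
and is the Stokes state `c = ĝ/(4π²N²ν)`: `V_N(g) ∖ {ν = 0}` is EXACTLY the Stokes hyperbola and its mirror. [folklore] -/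
theorem topShell_squeeze {N : ℕ} {g : ↥(PB N) → EuclideanSpace ℂ (Fin 3)} (hg : g ∈ galerkinSubspace (PB N))
    (htop : ∀ k : ↥(PB N), freqNormSq (k : Fin 3 → ℤ) ≠ (N : ℝ) ^ 2 → g k = 0)
    (hbel : ∀ k : ↥(PB N), curlVec (k : Fin 3 → ℤ) (g k) = ((2 * Real.pi * N : ℝ) : ℂ) • g k)
    {z : (↥(PB N) → EuclideanSpace ℂ (Fin 3)) × ℝ} (hz : z ∈ variety (PB N) g) (hν : z.2 ≠ 0) :
    (∀ k : ↥(PB N), curlVec (k : Fin 3 → ℤ) (z.1 k) = ((2 * Real.pi * N : ℝ) : ℂ) • z.1 k) ∧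
      z.1 = (4 * Real.pi ^ 2 * (N : ℝ) ^ 2 * z.2)⁻¹ • g := by
  set c := z.1 with hc
  set ν := z.2 with hνdef
  have hE := energy_identity (PB_symm N) hg.1 hz
  have hHel := visc_helicity_eq (helicityIdentity_holds (PB_symm N)) hg hz
  have hP2 : ∑ k : ↥(PB N), (inner ℂ (g k) (curlVec (k : Fin 3 → ℤ) (c k))).re =
      2 * Real.pi * N * ∑ k : ↥(PB N), (inner ℂ (g k) (c k)).re := by
    rw [Finset.mul_sum]
    refine Finset.sum_congr rfl fun k _ => ?_
    rw [← inner_curlVec_left, hbel k, re_inner_ofReal_smul_left]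
  have hkey : ∑ k : ↥(PB N), stokesW (k : Fin 3 → ℤ) *
      ((inner ℂ (c k) (curlVec (k : Fin 3 → ℤ) (c k))).re - 2 * Real.pi * N * ‖c k‖ ^ 2) = 0 := by
    have h4 : ν * ∑ k : ↥(PB N), stokesW (k : Fin 3 → ℤ) * (inner ℂ (c k) (curlVec (k : Fin 3 → ℤ) (c k))).re =
        ν * (2 * Real.pi * N * (4 * Real.pi ^ 2 * ∑ k : ↥(PB N), freqNormSq (k : Fin 3 → ℤ) * ‖c k‖ ^ 2)) := by
      rw [hHel, hP2, ← hE]; ring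
    have h5 := mul_left_cancel₀ hν h4
    simp only [mul_sub, Finset.sum_sub_distrib, h5, stokesW, Finset.mul_sum]
    rw [sub_eq_zero]
    exact Finset.sum_congr rfl fun k _ => by ring
  have hbelc := beltrami_of_sum_stokesW_mul_eq_zero hkey
  refine ⟨hbelc, ?_⟩
  -- `Q(c,c) = 0`, so `F = 0` is the linear Stokes system
  have hQ : projB (PB N) c c = 0 := projB_self_eq_zero_of_beltrami (zero_not_mem_PB N) hbelc
  have hF : -(ν • stokesA (PB N) c) + (fun k : ↥(PB N) => leraySym (k : Fin 3 → ℤ) (g k)) = 0 := by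
    have h := hz.2
    change Fmap (PB N) g z = 0 at h
    rw [Fmap_apply, hQ, sub_zero] at h
    exact h
  funext k
  have hFk := congrFun hF k
  rw [Pi.add_apply, Pi.neg_apply, Pi.smul_apply, leraySym_apply_of_mem hg, Pi.zero_apply, neg_add_eq_zero] at hFk
  -- hFk : ν • stokesA c k = g k   (false orientation handled below)
  rw [Pi.smul_apply, real_smul_vec]
  by_cases hkN : freqNormSq (k : Fin 3 → ℤ) = (N : ℝ) ^ 2
  · have h : ν • stokesA (PB N) c k = g k := hFk
    rw [stokesA, real_smul_vec, smul_smul, stokesW, hkN] at h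
    rw [← h, smul_smul, ← Complex.ofReal_mul, ← Complex.ofReal_mul]
    have hN : (N : ℝ) ≠ 0 := by
      intro hN0
      have hkpos : 0 < freqNormSq (k : Fin 3 → ℤ) := by
        have := one_le_sum_sq_of_ne_zero (mem_PB_iff.1 k.2).1
        rw [freqNormSq_eq_intCast]; exact_mod_cast this
      rw [hkN, hN0] at hkpos; simp at hkpos
    have hne : (4 * Real.pi ^ 2 * (N : ℝ) ^ 2 * ν : ℝ) ≠ 0 := by
      have : (0 : ℝ) < 4 * Real.pi ^ 2 * (N : ℝ) ^ 2 := by positivity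
      exact mul_ne_zero this.ne' hν
    rw [show (4 * Real.pi ^ 2 * (N : ℝ) ^ 2 * ν)⁻¹ * (ν * (4 * Real.pi ^ 2 * (N : ℝ) ^ 2)) = 1 by
      field_simp]
    simp
  · have h : ν • stokesA (PB N) c k = g k := hFk
    rw [htop k hkN] at h ⊢
    rw [smul_zero]
    rw [stokesA, real_smul_vec, smul_smul, ← Complex.ofReal_mul] at h
    have hne : (ν * stokesW (k : Fin 3 → ℤ) : ℝ) ≠ 0 := mul_ne_zero hν (stokesW_pos k).ne'
    rcases smul_eq_zero.1 h with h0 | h0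
    · exact absurd (Complex.ofReal_eq_zero.1 h0) hne
    · exact h0

/-- Corollary: off the zero-viscosity fibre the Stokes rate is attained EXACTLY, `ν²‖c‖² = ‖g‖²/(4π²N²)²`. [folklore] -/
theorem topShell_sq_mul_norm_sq_eq {N : ℕ} {g : ↥(PB N) → EuclideanSpace ℂ (Fin 3)} (hg : g ∈ galerkinSubspace (PB N))
    (htop : ∀ k : ↥(PB N), freqNormSq (k : Fin 3 → ℤ) ≠ (N : ℝ) ^ 2 → g k = 0)
    (hbel : ∀ k : ↥(PB N), curlVec (k : Fin 3 → ℤ) (g k) = ((2 * Real.pi * N : ℝ) : ℂ) • g k)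
    {z : (↥(PB N) → EuclideanSpace ℂ (Fin 3)) × ℝ} (hz : z ∈ variety (PB N) g) (hν : z.2 ≠ 0) :
    z.2 ^ 2 * ‖z.1‖ ^ 2 = (‖g‖ / (4 * Real.pi ^ 2 * (N : ℝ) ^ 2)) ^ 2 := by
  by_cases hN : N = 0
  · subst hN
    have hempty : ∀ k : ↥(PB 0), False := fun k => by
      have h1 : (1 : ℤ) ≤ ∑ i, (k : Fin 3 → ℤ) i ^ 2 := one_le_sum_sq_of_ne_zero (mem_PB_iff.1 k.2).1
      have h2 : (∑ i, (k : Fin 3 → ℤ) i ^ 2 : ℤ) ≤ 0 := by simpa using (mem_PB_iff.1 k.2).2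
      omega
    have hz0 : z.1 = 0 := funext fun k => (hempty k).elim
    have hg0 : g = 0 := funext fun k => (hempty k).elim
    rw [hz0, hg0]; simp
  · have hN' : (N : ℝ) ≠ 0 := Nat.cast_ne_zero.2 hN
    obtain ⟨-, hform⟩ := topShell_squeeze hg htop hbel hz hν
    rw [hform, norm_smul, Real.norm_eq_abs, abs_inv, mul_pow, inv_pow, sq_abs]
    have hpos : 0 < 4 * Real.pi ^ 2 * (N : ℝ) ^ 2 := by positivity
    field_simp

/-! ### Polarised energy and helicity identities at an arbitrary state -/

/-- **Polarised energy identity**: `∑_k Re⟪L_a v _k, v_k⟫ = -∑_k Re⟪Q_S(v,v)_k, a_k⟫` for `a, v` in the Galerkin space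
(`b(a,v,v) = 0` and `b(v,a,v) = -b(v,v,a)`). [folklore] -/
theorem sum_re_inner_symB_eq_neg (hS : ∀ k ∈ S, -k ∈ S) {a v : ↥S → EuclideanSpace ℂ (Fin 3)}
    (ha : a ∈ galerkinSubspace S) (hv : v ∈ galerkinSubspace S) :
    ∑ k : ↥S, (inner ℂ (symB S a v k) (v k)).re = -∑ k : ↥S, (inner ℂ (projB S v v k) (a k)).re := by
  have hac : IsConjSymm (coeffExt S a) := ha.1.isConjSymm_coeffExt hS
  have hvc : IsConjSymm (coeffExt S v) := hv.1.isConjSymm_coeffExt hS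
  have h1 : ∀ k : ↥S, (inner ℂ (symB S a v k) (v k)).re =
      (inner ℂ (convectionCoeff S (coeffExt S a) (coeffExt S v) k) (coeffExt S v k)).re +
        (inner ℂ (convectionCoeff S (coeffExt S v) (coeffExt S a) k) (coeffExt S v k)).re := by
    intro k
    rw [symB, Pi.add_apply, inner_add_left, Complex.add_re, projB, projB,
      inner_leraySym_left_of_transversal _ _ (hv.2 k), inner_leraySym_left_of_transversal _ _ (hv.2 k),
      coeffExt_coe]
  have h2 : ∀ k : ↥S, (inner ℂ (projB S v v k) (a k)).re =
      (inner ℂ (convectionCoeff S (coeffExt S v) (coeffExt S v) k) (coeffExt S a k)).re := by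
    intro k
    rw [projB, inner_leraySym_left_of_transversal _ _ (ha.2 k), coeffExt_coe]
  simp only [h1, h2, Finset.sum_add_distrib]
  rw [Finset.sum_coe_sort S (fun k => (inner ℂ (convectionCoeff S (coeffExt S a) (coeffExt S v) k) (coeffExt S v k)).re),
    Finset.sum_coe_sort S (fun k => (inner ℂ (convectionCoeff S (coeffExt S v) (coeffExt S a) k) (coeffExt S v k)).re),
    Finset.sum_coe_sort S (fun k => (inner ℂ (convectionCoeff S (coeffExt S v) (coeffExt S v) k) (coeffExt S a k)).re)]
  have hA := trilinear_antisymm hS hac hvc hvc ha.2.isTransversal_coeffExt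
  have hB := trilinear_antisymm hS hvc hac hvc hv.2.isTransversal_coeffExt
  linarith

/-- **Polarised helicity identity at an arbitrary state**: `∑_k Re⟪L_U v _k, 2πi k×U_k⟫ = -∑_k Re⟪Q_S(U,U)_k, 2πi k×v_k⟫`
for `U, v` in the Galerkin space (derivative of the cubic identity `helicityIdentity_holds`). [folklore] -/
theorem sum_re_inner_symB_curl_eq_neg (hS : ∀ k ∈ S, -k ∈ S) {U v : ↥S → EuclideanSpace ℂ (Fin 3)}
    (hU : U ∈ galerkinSubspace S) (hv : v ∈ galerkinSubspace S) :
    ∑ k : ↥S, (inner ℂ (symB S U v k) (curlVec (k : Fin 3 → ℤ) (U k))).re =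
      -∑ k : ↥S, (inner ℂ (projB S U U k) (curlVec (k : Fin 3 → ℤ) (v k))).re := by
  have hH := helicityIdentity_holds hS
  have h1 : helForm S (U + v) (U + v) (U + v) = 0 := hH _ (Submodule.add_mem _ hU hv)
  have h2 : helForm S (U - v) (U - v) (U - v) = 0 := hH _ (Submodule.sub_mem _ hU hv)
  have h3 : helForm S v v v = 0 := hH _ hv
  have hpol := helForm_polarise (S := S) U v
  rw [h1, h2, h3] at hpol
  have h5 : helForm S v U U + helForm S U v U + helForm S U U v = 0 := by linarith
  have h6 : ∑ k : ↥S, (inner ℂ (symB S U v k) (curlVec (k : Fin 3 → ℤ) (U k))).re =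
      helForm S U v U + helForm S v U U := by
    simp only [helForm, symB, Pi.add_apply, inner_add_left, Complex.add_re, Finset.sum_add_distrib]
  have h7 : ∑ k : ↥S, (inner ℂ (projB S U U k) (curlVec (k : Fin 3 → ℤ) (v k))).re = helForm S U U v := rfl
  rw [h6, h7]; linarith

end TopShell

end Summit.AnomalousDissipation.AnomalousDissipation.Theorems.GenericRunawayStokesScaling.Negative

end
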